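import Mathlib
import HarnessLib
import Summits.ValiantsHypothesis.ValiantsHypothesis.Theses.MonotoneRestoration
import Summits.ValiantsHypothesis.ValiantsHypothesis.Theorems.MonotoneRestorationMonotoneRestorationQPEpsilon
import Literature.Computability.AlgebraicComplexity.SymmetricCircuitLinCombSymmetry

/-!
# THEOREM ε, complex form — the crux is matrix-symmetric `RestorationQP` over `ℂ`

Support file for the crux item `stmt-ValiantsHypothesis-15886` (line `Sketch`, lead c3).
`monotoneRestorationQP_iff_complexRestorationQP`: `MonotoneRestorationQP` holds iff EVERY
matrix-symmetric `VP` family over `ℂ` (tree `IsVPFamily`) has square-symmetric circuits of size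
`2^((log₂ n + c)^c)` — literally `ProofCarryingSymmetry.RestorationQP` (stmt-10343) with the
diagonal invariance hypothesis strengthened to invariance under `S_n × S_n`. Proof: real and
imaginary parts of a matrix-symmetric `VP` family are real matrix-symmetric `VP` families
(`RealForms.exists_realPart_complexity_le`), THEOREM ε (`monotoneRestorationQP_iff_realRestorationQP`)
restores each, and the two symmetric circuits are combined by the Literature infrastructure
`LabelledArithCircuit.IsSymmetric.exists_linComb` (pairing + linear combination, landed for this line).
-/

set_option linter.dupNamespace false

namespace Summit.ValiantsHypothesis.ValiantsHypothesis.Theorems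

open Summit.ValiantsHypothesis.ValiantsHypothesis.Theses.MonotoneRestoration
open Literature.Computability.AlgebraicComplexity

/-- Uniqueness of the real/imaginary decomposition of a complex polynomial. [folklore] -/
theorem epsilonComplex_reIm_unique {σ : Type*} {x y x' y' : MvPolynomial σ ℝ}
    (h : MvPolynomial.map Complex.ofRealHom x + MvPolynomial.C Complex.I * MvPolynomial.map Complex.ofRealHom y =
      MvPolynomial.map Complex.ofRealHom x' + MvPolynomial.C Complex.I * MvPolynomial.map Complex.ofRealHom y') :
    x = x' ∧ y = y' := by
  have hc : ∀ m, ((MvPolynomial.coeff m x : ℝ) : ℂ) + Complex.I * ((MvPolynomial.coeff m y : ℝ) : ℂ) =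
      ((MvPolynomial.coeff m x' : ℝ) : ℂ) + Complex.I * ((MvPolynomial.coeff m y' : ℝ) : ℂ) := by
    intro m
    have := congrArg (MvPolynomial.coeff m) h
    simpa [MvPolynomial.coeff_map, MvPolynomial.coeff_C_mul] using this
  constructor
  · ext m
    have h1 := congrArg Complex.re (hc m)
    simpa using h1
  · ext m
    have h1 := congrArg Complex.im (hc m)
    simpa using h1

/-- Size bookkeeping: `2^((L+c₁)^c₁) + 2^((L+c₂)^c₂) + 8 ≤ 2^((L+c₃)^c₃)` with `c₃ = c₁ + c₂ + 4`.
[folklore] -/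
theorem epsilonComplex_size_le (c₁ c₂ : ℕ) : ∃ c₃ : ℕ, ∀ n : ℕ,
    2 ^ ((Nat.log 2 n + c₁) ^ c₁) + 2 ^ ((Nat.log 2 n + c₂) ^ c₂) + 8 ≤
      2 ^ ((Nat.log 2 n + c₃) ^ c₃) := by
  refine ⟨c₁ + c₂ + 4, fun n => ?_⟩
  generalize Nat.log 2 n = L
  set B : ℕ := L + (c₁ + c₂ + 4) with hB
  have hB4 : 4 ≤ B := by omega
  have hB1 : 1 ≤ B := by omega
  set M : ℕ := B ^ (c₁ + c₂ + 3) with hM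
  have hM3 : 3 ≤ M := by
    calc 3 ≤ B := by omega
      _ = B ^ 1 := (pow_one B).symm
      _ ≤ B ^ (c₁ + c₂ + 3) := Nat.pow_le_pow_right hB1 (by omega)
  have h1 : 2 ^ ((L + c₁) ^ c₁) ≤ 2 ^ M := by
    apply Nat.pow_le_pow_right (by norm_num)
    calc (L + c₁) ^ c₁ ≤ B ^ c₁ := Nat.pow_le_pow_left (by omega) c₁
      _ ≤ B ^ (c₁ + c₂ + 3) := Nat.pow_le_pow_right hB1 (by omega)
  have h2 : 2 ^ ((L + c₂) ^ c₂) ≤ 2 ^ M := by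
    apply Nat.pow_le_pow_right (by norm_num)
    calc (L + c₂) ^ c₂ ≤ B ^ c₂ := Nat.pow_le_pow_left (by omega) c₂
      _ ≤ B ^ (c₁ + c₂ + 3) := Nat.pow_le_pow_right hB1 (by omega)
  have h3 : 8 ≤ 2 ^ M := by
    calc (8 : ℕ) = 2 ^ 3 := by norm_num
      _ ≤ 2 ^ M := Nat.pow_le_pow_right (by norm_num) hM3
  have hpow : B ^ (c₁ + c₂ + 4) = M * B := by rw [hM]; ring
  have hexp : M + 2 ≤ B ^ (c₁ + c₂ + 4) := by
    rw [hpow]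
    calc M + 2 ≤ M * 4 := by omega
      _ ≤ M * B := Nat.mul_le_mul_left M hB4
  calc 2 ^ ((L + c₁) ^ c₁) + 2 ^ ((L + c₂) ^ c₂) + 8 ≤ 2 ^ M + 2 ^ M + 2 ^ M :=
        Nat.add_le_add (Nat.add_le_add h1 h2) h3
    _ ≤ 2 ^ M + 2 ^ M + 2 ^ M + 2 ^ M := Nat.le_add_right _ _
    _ = 2 ^ (M + 2) := by ring
    _ ≤ 2 ^ (B ^ (c₁ + c₂ + 4)) := Nat.pow_le_pow_right (by norm_num) hexp

/-- Arithmetic: `6 (n^c + c + 1) ≤ n^(6c+12) + (6c+12)`. [folklore] -/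
theorem epsilonComplex_six_mul_succ_le (n c : ℕ) :
    6 * (n ^ c + c + 1) ≤ n ^ (6 * c + 12) + (6 * c + 12) := by
  rcases Nat.lt_or_ge n 2 with hn | hn
  · interval_cases n
    · rcases Nat.eq_zero_or_pos c with rfl | hc
      · norm_num
      · rw [zero_pow hc.ne', zero_pow (by omega)]
        omega
    · simp only [one_pow]
      omega
  · have h : 6 * n ^ c ≤ n ^ (6 * c + 12) := by
      calc 6 * n ^ c ≤ 2 ^ 12 * n ^ c := Nat.mul_le_mul_right _ (by norm_num)
        _ ≤ n ^ 12 * n ^ c := Nat.mul_le_mul_right _ (Nat.pow_le_pow_left hn 12)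
        _ = n ^ (c + 12) := by ring
        _ ≤ n ^ (6 * c + 12) := Nat.pow_le_pow_right (by omega) (by omega)
    omega

/-- Real and imaginary parts of a matrix-symmetric `VP` family over `ℂ` are real matrix-symmetric
families whose complexifications are `VP` families. [folklore] -/
theorem epsilonComplex_reIm_parts (f : (n : ℕ) → MvPolynomial (Fin n × Fin n) ℂ)
    (hsymm : ∀ (n : ℕ) (σ τ : Equiv.Perm (Fin n)),
      MvPolynomial.rename (fun p : Fin n × Fin n => (σ p.1, τ p.2)) (f n) = f n)
    (hVP : IsVPFamily f) :
    ∃ x y : (n : ℕ) → MvPolynomial (Fin n × Fin n) ℝ,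
      (∀ n, f n = MvPolynomial.map Complex.ofRealHom (x n) +
        MvPolynomial.C Complex.I * MvPolynomial.map Complex.ofRealHom (y n)) ∧
      (∀ (n : ℕ) (σ τ : Equiv.Perm (Fin n)),
        MvPolynomial.rename (fun p : Fin n × Fin n => (σ p.1, τ p.2)) (x n) = x n) ∧
      (∀ (n : ℕ) (σ τ : Equiv.Perm (Fin n)),
        MvPolynomial.rename (fun p : Fin n × Fin n => (σ p.1, τ p.2)) (y n) = y n) ∧
      IsVPFamily (fun n => MvPolynomial.map Complex.ofRealHom (x n)) ∧
      IsVPFamily (fun n => MvPolynomial.map Complex.ofRealHom (y n)) := by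
  -- the parts, with their complexity bounds (real part of `f n` and of `-i · f n`)
  have key : ∀ n, ∃ x y : MvPolynomial (Fin n × Fin n) ℝ,
      f n = MvPolynomial.map Complex.ofRealHom x +
        MvPolynomial.C Complex.I * MvPolynomial.map Complex.ofRealHom y ∧
      complexity x ≤ 6 * complexity (f n) ∧ complexity y ≤ 6 * (complexity (f n) + 1) := by
    intro n
    obtain ⟨x, y, hxy, hx⟩ := RealForms.exists_realPart_complexity_le (f n)
    obtain ⟨x', y', hxy', hx'⟩ :=
      RealForms.exists_realPart_complexity_le (MvPolynomial.C (-Complex.I) * f n)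
    -- `-i f = y - i x`, so `x' = y`
    have hrel : MvPolynomial.map Complex.ofRealHom x' +
        MvPolynomial.C Complex.I * MvPolynomial.map Complex.ofRealHom y' =
        MvPolynomial.map Complex.ofRealHom y +
        MvPolynomial.C Complex.I * MvPolynomial.map Complex.ofRealHom (-x) := by
      rw [← hxy', hxy, map_neg, map_neg]
      linear_combination (-(MvPolynomial.map Complex.ofRealHom y)) *
        (RealForms.C_I_mul_C_I (σ := Fin n × Fin n))
    obtain ⟨hx'y, -⟩ := epsilonComplex_reIm_unique hrel
    refine ⟨x, y, hxy, hx, ?_⟩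
    rw [← hx'y]
    refine hx'.trans (Nat.mul_le_mul_left 6 ?_)
    calc complexity (MvPolynomial.C (-Complex.I) * f n)
        ≤ complexity (MvPolynomial.C (-Complex.I) : MvPolynomial (Fin n × Fin n) ℂ) +
            complexity (f n) + 1 := complexity_mul_le_holds _ _
      _ = complexity (f n) + 1 := by rw [complexity_C_holds]; ring
  choose x y hf hx hy using key
  -- symmetry of the parts from the symmetry of `f n` and uniqueness of the decomposition
  have hparts_symm : ∀ (n : ℕ) (σ τ : Equiv.Perm (Fin n)),
      MvPolynomial.rename (fun p : Fin n × Fin n => (σ p.1, τ p.2)) (x n) = x n ∧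
      MvPolynomial.rename (fun p : Fin n × Fin n => (σ p.1, τ p.2)) (y n) = y n := by
    intro n σ τ
    apply epsilonComplex_reIm_unique
    have h := hsymm n σ τ
    rw [hf n, map_add, map_mul, MvPolynomial.rename_C, ← MvPolynomial.map_rename,
      ← MvPolynomial.map_rename] at h
    exact h
  obtain ⟨⟨hcard, c₁, hc₁⟩, c₂, hc₂⟩ := hVP
  -- degrees of the parts are at most the degree of `f n`
  have hdeg : ∀ n, (x n).totalDegree ≤ (f n).totalDegree ∧ (y n).totalDegree ≤ (f n).totalDegree := by
    intro n
    have hsub : ∀ z : MvPolynomial (Fin n × Fin n) ℝ,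
        (∀ m, MvPolynomial.coeff m (f n) = 0 → MvPolynomial.coeff m z = 0) →
        z.totalDegree ≤ (f n).totalDegree := by
      intro z hz
      apply Finset.sup_mono
      intro m hm
      rw [MvPolynomial.mem_support_iff] at hm ⊢
      exact fun h0 => hm (hz m h0)
    have hcoef : ∀ m, MvPolynomial.coeff m (f n) =
        ((MvPolynomial.coeff m (x n) : ℝ) : ℂ) + Complex.I * ((MvPolynomial.coeff m (y n) : ℝ) : ℂ) := by
      intro m
      have := congrArg (MvPolynomial.coeff m) (hf n)
      simpa [MvPolynomial.coeff_map, MvPolynomial.coeff_C_mul] using this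
    constructor
    · refine hsub _ fun m hm => ?_
      have h := hcoef m; rw [hm] at h
      have := congrArg Complex.re h; simpa using this.symm
    · refine hsub _ fun m hm => ?_
      have h := hcoef m; rw [hm] at h
      have := congrArg Complex.im h; simpa using this.symm
  refine ⟨x, y, hf, fun n σ τ => (hparts_symm n σ τ).1, fun n σ τ => (hparts_symm n σ τ).2,
    ⟨⟨hcard, c₁, fun n => ?_⟩, ⟨6 * c₂ + 12, fun n => ?_⟩⟩,
    ⟨⟨hcard, c₁, fun n => ?_⟩, ⟨6 * c₂ + 12, fun n => ?_⟩⟩⟩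
  · -- degree of `x`
    have h1 : (f n).totalDegree ≤ n ^ c₁ + c₁ := hc₁ n
    calc (MvPolynomial.map Complex.ofRealHom (x n)).totalDegree = (x n).totalDegree :=
          MonotoneRestorationSensitive.totalDegree_map_of_injective Complex.ofRealHom.injective _
      _ ≤ (f n).totalDegree := (hdeg n).1
      _ ≤ n ^ c₁ + c₁ := h1
  · -- complexity of `x`
    have h1 : complexity (f n) ≤ n ^ c₂ + c₂ := hc₂ n
    calc complexity (MvPolynomial.map Complex.ofRealHom (x n)) ≤ complexity (x n) :=
          ArithCircuit.complexity_map_le _ _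
      _ ≤ 6 * complexity (f n) := hx n
      _ ≤ 6 * (n ^ c₂ + c₂ + 1) := Nat.mul_le_mul_left 6 (by omega)
      _ ≤ n ^ (6 * c₂ + 12) + (6 * c₂ + 12) := epsilonComplex_six_mul_succ_le n c₂
  · -- degree of `y`
    have h1 : (f n).totalDegree ≤ n ^ c₁ + c₁ := hc₁ n
    calc (MvPolynomial.map Complex.ofRealHom (y n)).totalDegree = (y n).totalDegree :=
          MonotoneRestorationSensitive.totalDegree_map_of_injective Complex.ofRealHom.injective _
      _ ≤ (f n).totalDegree := (hdeg n).2
      _ ≤ n ^ c₁ + c₁ := h1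
  · -- complexity of `y`
    have h1 : complexity (f n) ≤ n ^ c₂ + c₂ := hc₂ n
    calc complexity (MvPolynomial.map Complex.ofRealHom (y n)) ≤ complexity (y n) :=
          ArithCircuit.complexity_map_le _ _
      _ ≤ 6 * (complexity (f n) + 1) := hy n
      _ ≤ 6 * (n ^ c₂ + c₂ + 1) := Nat.mul_le_mul_left 6 (by omega)
      _ ≤ n ^ (6 * c₂ + 12) + (6 * c₂ + 12) := epsilonComplex_six_mul_succ_le n c₂

/-- **THEOREM ε, complex form — the crux is matrix-symmetric `RestorationQP` over `ℂ`.**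
`MonotoneRestorationQP` holds iff every family `f_n ∈ ℂ[x_ij]` invariant under independent row and
column permutations that is a `VP` family (tree `IsVPFamily`) has square-symmetric circuits over
`ℂ` of size `≤ 2^((log₂ n + c)^c)` computing it. (`→`: real and imaginary parts, THEOREM ε for each,
`IsSymmetric.exists_linComb`; `←`: a real family complexifies to a complex one, THEOREM ε.)
[cite: DwivediPagoSeppelt2026, Outlook Q3] -/
theorem monotoneRestorationQP_iff_complexRestorationQP :
    MonotoneRestorationQP ↔
    ∀ f : (n : ℕ) → MvPolynomial (Fin n × Fin n) ℂ,
      (∀ (n : ℕ) (σ τ : Equiv.Perm (Fin n)),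
        MvPolynomial.rename (fun p : Fin n × Fin n => (σ p.1, τ p.2)) (f n) = f n) →
      IsVPFamily f →
      ∃ c : ℕ, ∀ n : ℕ, ∃ (G : Type) (_ : Fintype G)
        (C : LabelledArithCircuit ℂ (Fin n × Fin n) Unit G),
        C.IsSymmetric (Equiv.Perm (Fin n)) ∧ C.eval (C.output ()) = f n ∧
          Fintype.card G ≤ 2 ^ ((Nat.log 2 n + c) ^ c) := by
  constructor
  · intro hMR f hsymm hVP
    have hR := monotoneRestorationQP_iff_realRestorationQP.mp hMR
    obtain ⟨x, y, hf, hx, hy, hxVP, hyVP⟩ := epsilonComplex_reIm_parts f hsymm hVP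
    obtain ⟨c₁, hc₁⟩ := hR x hx hxVP
    obtain ⟨c₂, hc₂⟩ := hR y hy hyVP
    obtain ⟨c₃, hc₃⟩ := epsilonComplex_size_le c₁ c₂
    refine ⟨c₃, fun n => ?_⟩
    obtain ⟨G₁, i₁, C₁, hs₁, he₁, hcard₁⟩ := hc₁ n
    obtain ⟨G₂, i₂, C₂, hs₂, he₂, hcard₂⟩ := hc₂ n
    obtain ⟨G, iG, C, hs, he, hcard⟩ :=
      LabelledArithCircuit.IsSymmetric.exists_linComb C₁ C₂ hs₁ hs₂ 1 Complex.I
    refine ⟨G, iG, C, hs, ?_, hcard.trans (le_trans (by omega) (hc₃ n))⟩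
    rw [he, he₁, he₂, hf n, MvPolynomial.C_1, one_mul]
  · intro hC
    refine monotoneRestorationQP_iff_realRestorationQP.mpr fun q hq hVP => ?_
    refine hC (fun n => MvPolynomial.map Complex.ofRealHom (q n)) (fun n σ τ => ?_) hVP
    rw [← MvPolynomial.map_rename, hq n σ τ]

end Summit.ValiantsHypothesis.ValiantsHypothesis.Theorems
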